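import Mathlib
import Summits.NavierStokesRegularity.NavierStokesRegularity.Theorems.EulerZoomLiouvillePowerGaugeEulerLiouvilleHoopCylinder
import Summits.NavierStokesRegularity.NavierStokesRegularity.Theorems.EulerZoomLiouvillePowerGaugeEulerLiouvilleHoopDensityBound
import HarnessLib

/-!
# HOOP LINE, H-CYL part 3 — polar coordinates on the end discs and the end-disc flux `endFlux`
# (route `EulerZoomLiouville`, crux E = stmt-NavierStokesRegularity-19832; class-free, `--supports` only)

The two-dimensional twin of `…HoopCylinder` for the end discs `{‖z‖ ≤ T₀} ⊂ E²` of the solid cylinder and the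
end-disc flux `HoopCore.endFlux V σ T₀ = ∫_{‖z‖ ≤ T₀} (V_r² + V_z²)(liftAt σ z)/‖z‖ dA(z)` of `…HoopDefs`:

* `setIntegral_closedBall_eq_setIntegral_box` — **product form, no integrability needed**:
  `∫_{‖z‖ ≤ T₀} G = ∫_{(t,θ) ∈ (0,T₀] × (−π,π)} t • G (t cos θ, t sin θ)`;
* `integrableOn_closedBall_iff` — `G` integrable on the disc iff `t • G (t cos θ, t sin θ)` is integrable on the box;
* `setIntegral_closedBall_eq` — iterated form `∫_{‖z‖ ≤ T₀} G = ∫₀^{T₀} t • ∫₀^{2π} G (t cos θ, t sin θ) dθ dt`;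
* `liftAt_eq_axisPt` — `liftAt σ (t cos θ, t sin θ) = axisPt σ t θ`;
* `integrableOn_endFlux_integrand`, `endFlux_eq` — for continuous `V` and `T₀ > 0` the flux integrand is integrable on
  the disc (the Jacobian `t` cancels `1/‖z‖`) and
  `endFlux V σ T₀ = ∫₀^{T₀} ∫₀^{2π} (V_r² + V_z²)(axisPt σ t θ) dθ dt`.

Route: `E² ≃ᵐ ℝ × ℝ` (volume preserving) and Mathlib's `polarCoord` (`integral_comp_polarCoord_symm`,
`integrableOn_image_iff_integrableOn_abs_det_fderiv_smul` with `hasFDerivAt_polarCoord_symm`, `det = t`).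

HONEST FRAME: tool lemmas for the K-HOOP assembly (c) / K-AXIS; nothing here is specific to Euler or Navier–Stokes;
19832 OPEN; NS regularity NOT proved.  [folklore (polar coordinates, Fubini)]
-/

noncomputable section

open MeasureTheory Set WithLp Metric Real
open scoped InnerProductSpace RealInnerProductSpace

set_option linter.dupNamespace false

namespace Summit.NavierStokesRegularity.NavierStokesRegularity.Theorems.PowerGaugeEulerLiouville.HoopCore

open Literature.Analysis.FluidPDE Condenser

/-! ### Polar coordinates on a disc of `E²` -/

/-- The identification `E² ≃ᵐ ℝ × ℝ` preserves Lebesgue measure. [folklore] -/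
theorem measurePreserving_toLp_symm_trans_finTwoArrow :
    MeasurePreserving ((MeasurableEquiv.toLp 2 (Fin 2 → ℝ)).symm.trans MeasurableEquiv.finTwoArrow) volume volume :=
  (EuclideanSpace.volume_preserving_symm_measurableEquiv_toLp (Fin 2)).trans (volume_preserving_finTwoArrow ℝ)

/-- Its inverse composed with `polarCoord.symm` is the polar point `(t cos θ, t sin θ)`. [folklore] -/
theorem toLp_symm_trans_finTwoArrow_symm_polarCoord_symm (p : ℝ × ℝ) :
    ((MeasurableEquiv.toLp 2 (Fin 2 → ℝ)).symm.trans MeasurableEquiv.finTwoArrow).symm (polarCoord.symm p)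
      = toLp 2 ![p.1 * Real.cos p.2, p.1 * Real.sin p.2] :=
  rfl

/-- The polar point has norm `t` (`t ≥ 0`). [folklore] -/
theorem norm_toLp_polar {t : ℝ} (ht : 0 ≤ t) (θ : ℝ) :
    ‖(toLp 2 ![t * Real.cos θ, t * Real.sin θ] : EuclideanSpace ℝ (Fin 2))‖ = t := by
  rw [EuclideanSpace.norm_eq, Fin.sum_univ_two]
  simp only [Real.norm_eq_abs, sq_abs]
  show √((t * Real.cos θ) ^ 2 + (t * Real.sin θ) ^ 2) = t
  rw [show (t * Real.cos θ) ^ 2 + (t * Real.sin θ) ^ 2 = t ^ 2 by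
      linear_combination t ^ 2 * Real.cos_sq_add_sin_sq θ, Real.sqrt_sq ht]

/-- The planar coordinate box `(0, T₀] × (−π, π)` lies in `polarCoord.target`. [folklore] -/
theorem discBox_subset_polarCoord_target (T₀ : ℝ) : Ioc 0 T₀ ×ˢ Ioo (-π) π ⊆ polarCoord.target :=
  fun _ hp => ⟨hp.1.1, hp.2⟩

/-- Pointwise bookkeeping: on `polarCoord.target`, the pulled-back indicator of the disc is the indicator of the box.
[folklore] -/
theorem indicator_closedBall_polar {F : Type*} [NormedAddCommGroup F] [NormedSpace ℝ F]
    (G : EuclideanSpace ℝ (Fin 2) → F) (T₀ : ℝ) {p : ℝ × ℝ} (hp : p ∈ polarCoord.target) :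
    p.1 • (closedBall (0 : EuclideanSpace ℝ (Fin 2)) T₀).indicator G (toLp 2 ![p.1 * Real.cos p.2, p.1 * Real.sin p.2])
      = (Ioc 0 T₀ ×ˢ Ioo (-π) π).indicator
          (fun p : ℝ × ℝ => p.1 • G (toLp 2 ![p.1 * Real.cos p.2, p.1 * Real.sin p.2])) p := by
  have ht : 0 < p.1 := hp.1
  have hmem : (toLp 2 ![p.1 * Real.cos p.2, p.1 * Real.sin p.2] : EuclideanSpace ℝ (Fin 2))
      ∈ closedBall (0 : EuclideanSpace ℝ (Fin 2)) T₀ ↔ p.1 ≤ T₀ := by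
    rw [mem_closedBall, dist_zero_right, norm_toLp_polar ht.le]
  by_cases hT : p.1 ≤ T₀
  · have h2 : p ∈ Ioc 0 T₀ ×ˢ Ioo (-π) π := ⟨⟨ht, hT⟩, hp.2⟩
    rw [indicator_of_mem (hmem.2 hT), indicator_of_mem h2]
  · have h2 : p ∉ Ioc 0 T₀ ×ˢ Ioo (-π) π := fun h => hT h.1.2
    rw [indicator_of_notMem (fun h => hT (hmem.1 h)), indicator_of_notMem h2, smul_zero]

/-- **Polar coordinates on a disc, product form** (no integrability needed): for every `G : E² → F`,
`∫_{‖z‖ ≤ T₀} G = ∫_{(t,θ) ∈ (0,T₀] × (−π,π)} t • G (t cos θ, t sin θ)`. [folklore] -/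
theorem setIntegral_closedBall_eq_setIntegral_box {F : Type*} [NormedAddCommGroup F] [NormedSpace ℝ F]
    (G : EuclideanSpace ℝ (Fin 2) → F) (T₀ : ℝ) :
    ∫ z in closedBall (0 : EuclideanSpace ℝ (Fin 2)) T₀, G z
      = ∫ p in Ioc 0 T₀ ×ˢ Ioo (-π) π, p.1 • G (toLp 2 ![p.1 * Real.cos p.2, p.1 * Real.sin p.2]) := by
  set T := (MeasurableEquiv.toLp 2 (Fin 2 → ℝ)).symm.trans MeasurableEquiv.finTwoArrow with hT
  have hTmp : MeasurePreserving T volume volume := measurePreserving_toLp_symm_trans_finTwoArrow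
  have h1 : ∫ z in closedBall (0 : EuclideanSpace ℝ (Fin 2)) T₀, G z
      = ∫ q, (closedBall (0 : EuclideanSpace ℝ (Fin 2)) T₀).indicator G (T.symm q) := by
    rw [← integral_indicator measurableSet_closedBall]
    exact (hTmp.symm.integral_comp' (g := (closedBall (0 : EuclideanSpace ℝ (Fin 2)) T₀).indicator G)).symm
  rw [h1, ← integral_comp_polarCoord_symm]
  calc ∫ p in polarCoord.target, p.1 • (closedBall (0 : EuclideanSpace ℝ (Fin 2)) T₀).indicator G
          (T.symm (polarCoord.symm p))
      = ∫ p in polarCoord.target, (Ioc 0 T₀ ×ˢ Ioo (-π) π).indicator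
          (fun p : ℝ × ℝ => p.1 • G (toLp 2 ![p.1 * Real.cos p.2, p.1 * Real.sin p.2])) p := by
        refine setIntegral_congr_fun polarCoord.open_target.measurableSet fun p hp => ?_
        rw [hT, toLp_symm_trans_finTwoArrow_symm_polarCoord_symm, indicator_closedBall_polar G T₀ hp]
    _ = ∫ p in Ioc 0 T₀ ×ˢ Ioo (-π) π, p.1 • G (toLp 2 ![p.1 * Real.cos p.2, p.1 * Real.sin p.2]) := by
        rw [setIntegral_indicator (measurableSet_Ioc.prod measurableSet_Ioo),
          inter_eq_right.mpr (discBox_subset_polarCoord_target T₀)]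

/-- **Integrability on a disc** ⇔ integrability of `t • G (t cos θ, t sin θ)` on the box `(0,T₀] × (−π,π)`. [folklore] -/
theorem integrableOn_closedBall_iff {F : Type*} [NormedAddCommGroup F] [NormedSpace ℝ F]
    (G : EuclideanSpace ℝ (Fin 2) → F) (T₀ : ℝ) :
    IntegrableOn G (closedBall (0 : EuclideanSpace ℝ (Fin 2)) T₀)
      ↔ IntegrableOn (fun p : ℝ × ℝ => p.1 • G (toLp 2 ![p.1 * Real.cos p.2, p.1 * Real.sin p.2]))
          (Ioc 0 T₀ ×ˢ Ioo (-π) π) := by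
  set T := (MeasurableEquiv.toLp 2 (Fin 2 → ℝ)).symm.trans MeasurableEquiv.finTwoArrow with hT
  have hTmp : MeasurePreserving T volume volume := measurePreserving_toLp_symm_trans_finTwoArrow
  set g : ℝ × ℝ → F := fun q => (closedBall (0 : EuclideanSpace ℝ (Fin 2)) T₀).indicator G (T.symm q) with hg
  have h1 : IntegrableOn G (closedBall (0 : EuclideanSpace ℝ (Fin 2)) T₀) ↔ Integrable g := by
    rw [← integrable_indicator_iff measurableSet_closedBall, hg]
    exact (hTmp.symm.integrable_comp_emb T.symm.measurableEmbedding).symm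
  have h2 : Integrable g ↔ IntegrableOn g (polarCoord.symm '' polarCoord.target) := by
    rw [polarCoord.symm_image_target_eq_source, ← integrableOn_univ,
      integrableOn_congr_set_ae polarCoord_source_ae_eq_univ]
  have hD : ∀ p ∈ polarCoord.target, HasFDerivWithinAt polarCoord.symm (fderivPolarCoordSymm p) polarCoord.target p :=
    fun p _ => (hasFDerivAt_polarCoord_symm p).hasFDerivWithinAt
  rw [h1, h2, integrableOn_image_iff_integrableOn_abs_det_fderiv_smul volume polarCoord.open_target.measurableSet hD
    polarCoord.symm.injOn g]
  have h3 : IntegrableOn (fun p : ℝ × ℝ => |(fderivPolarCoordSymm p).det| • g (polarCoord.symm p)) polarCoord.target ↔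
      IntegrableOn ((Ioc 0 T₀ ×ˢ Ioo (-π) π).indicator
        (fun p : ℝ × ℝ => p.1 • G (toLp 2 ![p.1 * Real.cos p.2, p.1 * Real.sin p.2]))) polarCoord.target := by
    refine integrableOn_congr_fun (fun p hp => ?_) polarCoord.open_target.measurableSet
    simp only [hg]
    rw [det_fderivPolarCoordSymm, abs_of_pos hp.1, hT, toLp_symm_trans_finTwoArrow_symm_polarCoord_symm,
      indicator_closedBall_polar G T₀ hp]
  rw [h3, IntegrableOn, integrable_indicator_iff (measurableSet_Ioc.prod measurableSet_Ioo), IntegrableOn,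
    Measure.restrict_restrict (measurableSet_Ioc.prod measurableSet_Ioo),
    inter_eq_left.mpr (discBox_subset_polarCoord_target T₀)]
  rfl

/-- The angular integral over `(−π, π)` with the Jacobian pulled out and the window moved to `(0, 2π)`. [folklore] -/
theorem setIntegral_Ioo_smul_polar {F : Type*} [NormedAddCommGroup F] [NormedSpace ℝ F]
    (G : EuclideanSpace ℝ (Fin 2) → F) (t : ℝ) :
    ∫ θ in Ioo (-π) π, t • G (toLp 2 ![t * Real.cos θ, t * Real.sin θ])
      = t • ∫ θ in (0 : ℝ)..2 * π, G (toLp 2 ![t * Real.cos θ, t * Real.sin θ]) := by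
  rw [integral_smul, setIntegral_congr_set (Ioo_ae_eq_Ioc : Ioo (-π) π =ᵐ[(volume : Measure ℝ)] Ioc (-π) π),
    ← intervalIntegral.integral_of_le (by linarith [pi_pos] : -π ≤ π)]
  congr 1
  have hper : Function.Periodic (fun θ => G (toLp 2 ![t * Real.cos θ, t * Real.sin θ])) (2 * π) := by
    intro θ
    simp only [Real.cos_add_two_pi, Real.sin_add_two_pi]
  have h := hper.intervalIntegral_add_eq (-π) 0
  rw [show -π + 2 * π = π by ring, zero_add] at h
  exact h

/-- **Polar coordinates on a disc, iterated form**: for `G` integrable on the disc and `0 ≤ T₀`,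
`∫_{‖z‖ ≤ T₀} G = ∫₀^{T₀} t • (∫₀^{2π} G (t cos θ, t sin θ) dθ) dt`. [folklore] -/
theorem setIntegral_closedBall_eq {F : Type*} [NormedAddCommGroup F] [NormedSpace ℝ F]
    (G : EuclideanSpace ℝ (Fin 2) → F) {T₀ : ℝ}
    (hG : IntegrableOn G (closedBall (0 : EuclideanSpace ℝ (Fin 2)) T₀)) (hT : 0 ≤ T₀) :
    ∫ z in closedBall (0 : EuclideanSpace ℝ (Fin 2)) T₀, G z
      = ∫ t in (0 : ℝ)..T₀, t • ∫ θ in (0 : ℝ)..2 * π, G (toLp 2 ![t * Real.cos θ, t * Real.sin θ]) := by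
  have hI := (integrableOn_closedBall_iff G T₀).1 hG
  have hF : ∫ p in Ioc 0 T₀ ×ˢ Ioo (-π) π, p.1 • G (toLp 2 ![p.1 * Real.cos p.2, p.1 * Real.sin p.2])
      = ∫ t in Ioc 0 T₀, ∫ θ in Ioo (-π) π, t • G (toLp 2 ![t * Real.cos θ, t * Real.sin θ]) :=
    setIntegral_prod _ hI
  rw [setIntegral_closedBall_eq_setIntegral_box, hF, intervalIntegral.integral_of_le hT]
  simp only [setIntegral_Ioo_smul_polar]

/-! ### The end-disc flux -/

/-- `liftAt σ (t cos θ, t sin θ) = axisPt σ t θ`. [folklore] -/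
theorem liftAt_eq_axisPt (σ t θ : ℝ) :
    liftAt σ (toLp 2 ![t * Real.cos θ, t * Real.sin θ]) = axisPt σ t θ := by
  rw [axisPt_eq_toLp]
  rfl

/-- Components are bounded by the norm: `|V_r (y)| ≤ ‖V y‖` at a circle point off the axis and `|V_z (y)| ≤ ‖V y‖`.
[folklore] -/
theorem radialVelocity_sq_add_axialVelocity_sq_le (V : EuclideanSpace ℝ (Fin 3) → EuclideanSpace ℝ (Fin 3))
    (σ : ℝ) {t : ℝ} (ht : 0 < t) (θ : ℝ) :
    (radialVelocity V (axisPt σ t θ)) ^ 2 + (axialVelocity V (axisPt σ t θ)) ^ 2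
      ≤ 2 * ‖V (axisPt σ t θ)‖ ^ 2 := by
  have h1 : |radialVelocity V (axisPt σ t θ)| ≤ ‖V (axisPt σ t θ)‖ := by
    rw [radialVelocity, eR_axisPt σ ht θ]
    calc |⟪V (axisPt σ t θ), rotZ θ (EuclideanSpace.single (0 : Fin 3) (1 : ℝ))⟫|
        ≤ ‖V (axisPt σ t θ)‖ * ‖rotZ θ (EuclideanSpace.single (0 : Fin 3) (1 : ℝ))‖ := abs_real_inner_le_norm _ _
      _ = ‖V (axisPt σ t θ)‖ := by rw [norm_rotZ_single_zero, mul_one]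
  have h2 : (axialVelocity V (axisPt σ t θ)) ^ 2 ≤ ‖V (axisPt σ t θ)‖ ^ 2 := by
    rw [axialVelocity, EuclideanSpace.real_norm_sq_eq (V (axisPt σ t θ))]
    exact Finset.single_le_sum (f := fun i => (V (axisPt σ t θ) i) ^ 2) (fun i _ => sq_nonneg _)
      (Finset.mem_univ 2)
  have h1' : (radialVelocity V (axisPt σ t θ)) ^ 2 ≤ ‖V (axisPt σ t θ)‖ ^ 2 := by
    rw [← sq_abs]
    exact pow_le_pow_left₀ (abs_nonneg _) h1 2
  linarith

/-- **The end-disc flux integrand is integrable on the disc** (`V` continuous, `T₀ > 0`): in polar coordinates the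
Jacobian `t` cancels `1/‖z‖`, and what is left, `(V_r² + V_z²)(axisPt σ t θ) ≤ 2‖V‖²`, is bounded and measurable on
the box. [folklore] -/
theorem integrableOn_endFlux_integrand {V : EuclideanSpace ℝ (Fin 3) → EuclideanSpace ℝ (Fin 3)} (hV : Continuous V)
    (σ : ℝ) {T₀ : ℝ} (hT₀ : 0 < T₀) :
    IntegrableOn (fun z : EuclideanSpace ℝ (Fin 2) =>
        ((radialVelocity V (liftAt σ z)) ^ 2 + (axialVelocity V (liftAt σ z)) ^ 2) / ‖z‖)
      (closedBall (0 : EuclideanSpace ℝ (Fin 2)) T₀) := by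
  rw [integrableOn_closedBall_iff]
  have hbox : MeasurableSet (Ioc 0 T₀ ×ˢ Ioo (-π) π : Set (ℝ × ℝ)) := measurableSet_Ioc.prod measurableSet_Ioo
  -- on the box the pulled-back integrand is `(V_r² + V_z²)(axisPt σ t θ)`
  have heq : EqOn
      (fun p : ℝ × ℝ => p.1 • (fun z : EuclideanSpace ℝ (Fin 2) =>
        ((radialVelocity V (liftAt σ z)) ^ 2 + (axialVelocity V (liftAt σ z)) ^ 2) / ‖z‖)
          (toLp 2 ![p.1 * Real.cos p.2, p.1 * Real.sin p.2]))
      (fun p : ℝ × ℝ => (radialVelocity V (axisPt σ p.1 p.2)) ^ 2 + (axialVelocity V (axisPt σ p.1 p.2)) ^ 2)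
      (Ioc 0 T₀ ×ˢ Ioo (-π) π) := by
    intro p hp
    have ht : 0 < p.1 := hp.1.1
    simp only []
    rw [norm_toLp_polar ht.le, liftAt_eq_axisPt, smul_eq_mul]
    field_simp
  rw [integrableOn_congr_fun heq hbox]
  -- bounded and measurable on a set of finite measure
  obtain ⟨M, hM⟩ : ∃ M, ∀ y ∈ closedBall (0 : EuclideanSpace ℝ (Fin 3)) (|σ| + T₀), ‖V y‖ ≤ M :=
    (isCompact_closedBall _ _).exists_bound_of_continuousOn hV.continuousOn
  have hmeas : Measurable fun p : ℝ × ℝ =>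
      (radialVelocity V (axisPt σ p.1 p.2)) ^ 2 + (axialVelocity V (axisPt σ p.1 p.2)) ^ 2 := by
    have hR : Measurable (eR : EuclideanSpace ℝ (Fin 3) → EuclideanSpace ℝ (Fin 3)) := by
      have h1 : Measurable fun x : EuclideanSpace ℝ (Fin 3) => (cylRadius x)⁻¹ :=
        continuous_cylRadius.measurable.inv
      have h2 : Continuous fun x : EuclideanSpace ℝ (Fin 3) =>
          (toLp 2 ![x 0, x 1, 0] : EuclideanSpace ℝ (Fin 3)) := by
        fun_prop
      exact h1.smul h2.measurable
    have hax : Continuous fun p : ℝ × ℝ => axisPt σ p.1 p.2 := by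
      have h := continuous_axisPt.comp ((continuous_const (y := σ)).prodMk (continuous_id (X := ℝ × ℝ)))
      exact h.congr fun p => rfl
    have hrad : Measurable (radialVelocity V) := by
      unfold radialVelocity
      exact hV.measurable.inner hR
    have haxial : Continuous (axialVelocity V) := by
      unfold axialVelocity
      exact (PiLp.continuous_apply 2 _ 2).comp hV
    exact ((hrad.comp hax.measurable).pow_const 2).add ((haxial.measurable.comp hax.measurable).pow_const 2)
  refine Measure.integrableOn_of_bounded ?_ hmeas.aestronglyMeasurable (M := 2 * M ^ 2) ?_
  · exact (lt_of_le_of_lt (measure_mono (prod_mono Ioc_subset_Icc_self Ioo_subset_Icc_self))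
      ((isCompact_Icc.prod isCompact_Icc).measure_lt_top (μ := (volume : Measure (ℝ × ℝ))))).ne
  · rw [ae_restrict_iff' hbox]
    refine ae_of_all _ fun p hp => ?_
    have ht : 0 < p.1 := hp.1.1
    have hy : axisPt σ p.1 p.2 ∈ closedBall (0 : EuclideanSpace ℝ (Fin 3)) (|σ| + T₀) := by
      rw [mem_closedBall, dist_zero_right]
      have hn := norm_sq_axisPt σ p.1 p.2
      have hpt : p.1 ^ 2 ≤ T₀ ^ 2 := by nlinarith [hp.1.2]
      have h2 : ‖axisPt σ p.1 p.2‖ ^ 2 ≤ (|σ| + T₀) ^ 2 := by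
        rw [hn]; nlinarith [abs_nonneg σ, sq_abs σ, hT₀.le]
      calc ‖axisPt σ p.1 p.2‖ = √(‖axisPt σ p.1 p.2‖ ^ 2) := (Real.sqrt_sq (norm_nonneg _)).symm
        _ ≤ √((|σ| + T₀) ^ 2) := Real.sqrt_le_sqrt h2
        _ = |σ| + T₀ := Real.sqrt_sq (by positivity)
    have hVy := hM _ hy
    have hnn : 0 ≤ (radialVelocity V (axisPt σ p.1 p.2)) ^ 2 + (axialVelocity V (axisPt σ p.1 p.2)) ^ 2 := by
      positivity
    rw [Real.norm_eq_abs, abs_of_nonneg hnn]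
    calc (radialVelocity V (axisPt σ p.1 p.2)) ^ 2 + (axialVelocity V (axisPt σ p.1 p.2)) ^ 2
        ≤ 2 * ‖V (axisPt σ p.1 p.2)‖ ^ 2 := radialVelocity_sq_add_axialVelocity_sq_le V σ ht p.2
      _ ≤ 2 * M ^ 2 := by
          have h0 := norm_nonneg (V (axisPt σ p.1 p.2))
          nlinarith

/-- **The end-disc flux in polar coordinates** (`V` continuous, `T₀ > 0`):
`endFlux V σ T₀ = ∫₀^{T₀} ∫₀^{2π} ((V_r)² + (V_z)²)(axisPt σ t θ) dθ dt` — the Jacobian `t` cancels the weight `1/‖z‖`.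
[folklore] -/
theorem endFlux_eq {V : EuclideanSpace ℝ (Fin 3) → EuclideanSpace ℝ (Fin 3)} (hV : Continuous V) (σ : ℝ) {T₀ : ℝ}
    (hT₀ : 0 < T₀) :
    endFlux V σ T₀ = ∫ t in (0 : ℝ)..T₀, ∫ θ in (0 : ℝ)..2 * π,
      ((radialVelocity V (axisPt σ t θ)) ^ 2 + (axialVelocity V (axisPt σ t θ)) ^ 2) := by
  unfold endFlux
  rw [setIntegral_closedBall_eq _ (integrableOn_endFlux_integrand hV σ hT₀) hT₀.le,
    intervalIntegral.integral_of_le hT₀.le, intervalIntegral.integral_of_le hT₀.le]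
  refine setIntegral_congr_fun measurableSet_Ioc fun t ht => ?_
  rw [← intervalIntegral.integral_smul]
  refine intervalIntegral.integral_congr fun θ _ => ?_
  simp only []
  rw [norm_toLp_polar ht.1.le, liftAt_eq_axisPt, smul_eq_mul]
  exact mul_div_cancel₀ _ ht.1.ne'

end Summit.NavierStokesRegularity.NavierStokesRegularity.Theorems.PowerGaugeEulerLiouville.HoopCore

end
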